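import Summits.ValiantsHypothesis.ValiantsHypothesis.Theorems.LacunarySymmetroidMatrixDescartesCensusPivotDefs
import Literature.Geometry.Symplectic.PfaffianFour

/-!
# `MatrixDescartes` census — pivot column: the SECULAR KINK LAW «one root per kink» is FALSE (eleven roots on nine kinks)

HONEST FRAMING.  NEGATIVE KNOWLEDGE for the object-search cell `pub-symmetroid`'s Conjecture-B column in pivot currency
(`…CensusPivotDefs.lean`), typed on the desk's instruction R1359 (4) («type `SecularKinkLaw` ONLY TOGETHER WITH `not_secularKinkLaw`,
never as a candidate»); statement, witness and proof by conjb-1 g3 (`pub-symmetroid-conjb-1/g3/lean/NotSecularKinkLaw.lean`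
e05baa6112883606, farm rc 0, 2026-08-26; `g3/ROUND3-MEMO.md` §3; exact certificate `g3/num/cert_pruned_mpx.out`), ported onto the tree's
shared `Pivot.pivotPosRoots` by the typer g8 (the local copy of that definition is replaced by the import; everything else is conjb-1's,
with docstrings added).  THE LAW (conjb-1 g3's morning conjecture of ROUND 3, now REFUTED): in the SECULAR CORNER (diagonal PSD letters
`Pₖ = diag(cₖ)`, index-1 pivot `J = diag γ − w wᵀ`, `γ ≥ 0`) the positive-root count is at most `1 + Σᵢ κᵢ`, where the KINK NUMBER
`κᵢ = |{dₖ : cₖᵢ ≠ 0} ∪ {e}| − 1` counts the tropical breakpoints of channel `i` (pivot exponent included).  THE WITNESS: monomial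
pruning of conjb-1 g2's time-multiplexed staircase (`…CensusPivotMultiplexK4.lean`) — deleting the two never-dominant `x¹⁶` monomials
of channels 2 and 4 keeps all eleven positive roots while `Σκ` drops to `2 + 2 + 3 + 2 = 9 < 10`: `(m, K) = (4, 4)`, `e = 4`, letters
at exponents `0, 5, 6, 16`, `γ = (1/2, 9259/10⁴, 2493/5000, 9259/10⁴)`, `w = 𝟙`; `det F = Π qᵢ − x⁴ Σᵢ Π_{j≠i} q_j` has signs
`− + − + − + − + − + − +` at `31/1000, 59/125, 113/125, 139/100, 19/10, 104/5, 91, 472, 904, 1400, 1890, 27300` ⇒ `≥ 11` roots, while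
`1 + Σκ ≤ 10`.  What survives (conjb-1 g3 CARD 1 of record, typed def-only in their `ConjB1SketchR4.lean`, NOT here): the MONOMIAL
COUNT LAW `Z₊ ≤ N − 1`, `N = Σᵢ |supp qᵢ|`.
Landed as a HELPER of the crux item stmt-ValiantsHypothesis-18050 with no closure claim; index-1 pivot pencils only — nothing here bears
on `Theses.LacunarySymmetroid.MatrixDescartes`, on `KPlusLogSqLaw`, on the census registers (not a Table-S row), or on `VP ≠ VNP`.

[folklore] Intermediate value theorem at rational points (`norm_num`), `4 × 4` cofactor expansion
(`Literature.Geometry.Symplectic.matrix_det_fin_four`); statement and object are the cell's (conjb-1 g3).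
-/

-- `Summit.ValiantsHypothesis.ValiantsHypothesis.…` repeats a component by the D-0017 layout
-- (single-conjunct summit), which the `dupNamespace` linter flags; the name is mandated.
set_option linter.dupNamespace false

namespace Summit.ValiantsHypothesis.ValiantsHypothesis.Theorems.LacunarySymmetroidMatrixDescartes.Pivot

open Polynomial Matrix Finset
open scoped BigOperators

/-- **Kink number of channel `i`** in the secular corner: `κᵢ = |{dₖ : cₖᵢ ≠ 0} ∪ {e}| − 1` — the number of tropical breakpoints of
the channel `qᵢ(x) = γᵢ x^e + Σₖ cₖᵢ x^{dₖ}` counted with the pivot exponent (`c k i` = the `i`-th diagonal entry of the `k`-th letter).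
[definition of the cell (conjb-1 g3, `ConjB1SketchR4.lean`); no citation exists] -/
noncomputable def kinkNumber {m K : ℕ} (e : ℕ) (d : Fin K → ℕ) (c : Fin K → Fin m → ℝ) (i : Fin m) : ℕ :=
  (insert e ((Finset.univ.filter (fun k => c k i ≠ 0)).image d)).card - 1

/-- **SECULAR KINK LAW «one root per kink»** (conjb-1 g3's ROUND-3 morning conjecture): in the secular corner — diagonal PSD letters
`diag(c k)` (`c ≥ 0`), pivot `diag γ − w wᵀ` with `γ ≥ 0` (index `1`) — `Z₊ ≤ 1 + Σᵢ κᵢ`.  STATUS: **REFUTED** (`not_secularKinkLaw`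
below: eleven roots on nine kinks); typed here ONLY as the target of that refutation (desk R1359 (4)), never a candidate.
[conjecture of the cell (conjb-1 g3), refuted; no citation exists] -/
def SecularKinkLaw : Prop :=
  ∀ (m K e : ℕ) (d : Fin K → ℕ) (γ w : Fin m → ℝ) (c : Fin K → Fin m → ℝ),
    (∀ i, 0 ≤ γ i) → (∀ k i, 0 ≤ c k i) →
    pivotPosRoots e d (Matrix.diagonal γ - Matrix.vecMulVec w w) (fun k => Matrix.diagonal (c k))
      ≤ 1 + ∑ i, kinkNumber e d c i

namespace KinkLaw

/-! ## The witness -/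

/-- `γ = (1/2, 9259/10⁴, 2493/5000, 9259/10⁴)`: the diagonal of `J + 𝟙𝟙ᵀ`. -/
noncomputable def γs : Fin 4 → ℝ := ![1/2, 9259/10000, 2493/5000, 9259/10000]
/-- `w = 𝟙` (all ones). -/
noncomputable def ws : Fin 4 → ℝ := fun _ => 1
/-- exponents `(0, 5, 6, 16)` of the four diagonal PSD letters. -/
def ds : Fin 4 → ℕ := ![0, 5, 6, 16]
/-- diagonal entries of the four PSD letters (rows: letters at exponents 0, 5, 6, 16; columns: channels 1..4) -/
noncomputable def cs : Fin 4 → (Fin 4 → ℝ) :=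
  ![![0, 1543/5000, 2480000, 308600000000],
    ![3/2, 0, 3/2000, 0],
    ![0, 1207/100000, 0, 247/20000000000],
    ![3/4, 0, 3/4000000000000000000000000000000000000, 0]]

/-- the pivot letter `J = diag γ − 𝟙𝟙ᵀ` (index `1`). -/
noncomputable def Jw : Matrix (Fin 4) (Fin 4) ℝ := Matrix.diagonal γs - Matrix.vecMulVec ws ws
/-- the four diagonal PSD letters. -/
noncomputable def Pw (k : Fin 4) : Matrix (Fin 4) (Fin 4) ℝ := Matrix.diagonal (cs k)

/-- `γ ≥ 0`. -/
theorem γs_nonneg : ∀ i, 0 ≤ γs i := by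
  intro i; fin_cases i <;> simp [γs] <;> norm_num

/-- all letter entries are `≥ 0`. -/
theorem cs_nonneg : ∀ k i, 0 ≤ cs k i := by
  intro k i; fin_cases k <;> fin_cases i <;> simp [cs] <;> norm_num

/-- The determinant of the witness pencil. -/
noncomputable def detS : ℝ[X] :=
  Matrix.det (((X : ℝ[X]) ^ 4) • Jw.map Polynomial.C + ∑ k, ((X : ℝ[X]) ^ ds k) • (Pw k).map Polynomial.C)

/-- channel 1: `(1/2)x⁴ + (3/2)x⁵ + (3/4)x¹⁶`. -/
noncomputable def q1 (t : ℝ) : ℝ := 1/2 * t ^ 4 + 3/2 * t ^ 5 + 3/4 * t ^ 16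
/-- channel 2: `1543/5000 + (9259/10⁴)x⁴ + (1207/10⁵)x⁶`. -/
noncomputable def q2 (t : ℝ) : ℝ := 1543/5000 + 9259/10000 * t ^ 4 + 1207/100000 * t ^ 6
/-- channel 3: `2480000 + (2493/5000)x⁴ + (3/2000)x⁵ + (3/(4·10³⁶))x¹⁶`. -/
noncomputable def q3 (t : ℝ) : ℝ := 2480000 + 2493/5000 * t ^ 4 + 3/2000 * t ^ 5
    + 3/4000000000000000000000000000000000000 * t ^ 16
/-- channel 4: `3086·10⁸ + (9259/10⁴)x⁴ + (247/(2·10¹⁰))x⁶`. -/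
noncomputable def q4 (t : ℝ) : ℝ := 308600000000 + 9259/10000 * t ^ 4 + 247/20000000000 * t ^ 6

/-- Closed form `Π qᵢ − x⁴ Σᵢ Π_{j≠i} q_j` of the witness determinant (cofactor expansion + `ring`). [folklore] -/
theorem detS_eval (t : ℝ) : detS.eval t =
    q1 t * q2 t * q3 t * q4 t
      - t ^ 4 * ((q2 t * q3 t * q4 t) + (q1 t * q3 t * q4 t) + (q1 t * q2 t * q4 t) + (q1 t * q2 t * q3 t)) := by
  unfold detS Jw Pw
  rw [← Polynomial.coe_evalRingHom, RingHom.map_det, Literature.Geometry.Symplectic.matrix_det_fin_four]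
  simp [RingHom.mapMatrix_apply, Matrix.map_apply, Fin.sum_univ_four, γs, ws, cs, ds, Matrix.add_apply, Matrix.sub_apply,
    Matrix.smul_apply, Matrix.diagonal, Matrix.vecMulVec_apply, q1, q2, q3, q4]
  ring

/-- the witness determinant is not the zero polynomial. -/
theorem detS_ne_zero : detS ≠ 0 := by
  intro h
  have h1 := detS_eval 27300
  rw [h, eval_zero] at h1
  norm_num [q1, q2, q3, q4] at h1

/-- sign change ⇒ a root strictly inside -/
theorem exists_root_of_sign_change {a b : ℝ} (hab : a ≤ b) (ha : detS.eval a < 0 ∨ 0 < detS.eval a)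
    (h : detS.eval a * detS.eval b < 0) : ∃ r ∈ Set.Ioo a b, detS.IsRoot r := by
  have hcont : ContinuousOn (fun x => detS.eval x) (Set.Icc a b) := detS.continuous.continuousOn
  rcases ha with ha | ha
  · have hb : 0 < detS.eval b := by
      by_contra hb; push Not at hb; nlinarith
    obtain ⟨r, hr, hr0⟩ := intermediate_value_Ioo hab hcont ⟨ha, hb⟩
    exact ⟨r, hr, hr0⟩
  · have hb : detS.eval b < 0 := by
      by_contra hb; push Not at hb; nlinarith
    obtain ⟨r, hr, hr0⟩ := intermediate_value_Ioo' hab hcont ⟨hb, ha⟩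
    exact ⟨r, hr, hr0⟩

/-! ## Signs at twelve rational points -/

/-- sign of the witness determinant at test point 1 of 12. -/
theorem sign1 : detS.eval (31/1000) < 0 := by rw [detS_eval]; norm_num [q1, q2, q3, q4]
/-- sign of the witness determinant at test point 2 of 12. -/
theorem sign2 : 0 < detS.eval (59/125) := by rw [detS_eval]; norm_num [q1, q2, q3, q4]
/-- sign of the witness determinant at test point 3 of 12. -/
theorem sign3 : detS.eval (113/125) < 0 := by rw [detS_eval]; norm_num [q1, q2, q3, q4]
/-- sign of the witness determinant at test point 4 of 12. -/
theorem sign4 : 0 < detS.eval (139/100) := by rw [detS_eval]; norm_num [q1, q2, q3, q4]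
/-- sign of the witness determinant at test point 5 of 12. -/
theorem sign5 : detS.eval (19/10) < 0 := by rw [detS_eval]; norm_num [q1, q2, q3, q4]
/-- sign of the witness determinant at test point 6 of 12. -/
theorem sign6 : 0 < detS.eval (104/5) := by rw [detS_eval]; norm_num [q1, q2, q3, q4]
/-- sign of the witness determinant at test point 7 of 12. -/
theorem sign7 : detS.eval 91 < 0 := by rw [detS_eval]; norm_num [q1, q2, q3, q4]
/-- sign of the witness determinant at test point 8 of 12. -/
theorem sign8 : 0 < detS.eval 472 := by rw [detS_eval]; norm_num [q1, q2, q3, q4]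
/-- sign of the witness determinant at test point 9 of 12. -/
theorem sign9 : detS.eval 904 < 0 := by rw [detS_eval]; norm_num [q1, q2, q3, q4]
/-- sign of the witness determinant at test point 10 of 12. -/
theorem sign10 : 0 < detS.eval 1400 := by rw [detS_eval]; norm_num [q1, q2, q3, q4]
/-- sign of the witness determinant at test point 11 of 12. -/
theorem sign11 : detS.eval 1890 < 0 := by rw [detS_eval]; norm_num [q1, q2, q3, q4]
/-- sign of the witness determinant at test point 12 of 12. -/
theorem sign12 : 0 < detS.eval 27300 := by rw [detS_eval]; norm_num [q1, q2, q3, q4]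

/-- **Eleven distinct positive roots.** -/
theorem eleven_le_pivotPosRoots : 11 ≤ pivotPosRoots 4 ds Jw Pw := by
  obtain ⟨r₁, hr₁, h₁⟩ := exists_root_of_sign_change (a := 31/1000) (b := 59/125) (by norm_num) (Or.inl sign1)
    (mul_neg_of_neg_of_pos sign1 sign2)
  obtain ⟨r₂, hr₂, h₂⟩ := exists_root_of_sign_change (a := 59/125) (b := 113/125) (by norm_num) (Or.inr sign2)
    (mul_neg_of_pos_of_neg sign2 sign3)
  obtain ⟨r₃, hr₃, h₃⟩ := exists_root_of_sign_change (a := 113/125) (b := 139/100) (by norm_num) (Or.inl sign3)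
    (mul_neg_of_neg_of_pos sign3 sign4)
  obtain ⟨r₄, hr₄, h₄⟩ := exists_root_of_sign_change (a := 139/100) (b := 19/10) (by norm_num) (Or.inr sign4)
    (mul_neg_of_pos_of_neg sign4 sign5)
  obtain ⟨r₅, hr₅, h₅⟩ := exists_root_of_sign_change (a := 19/10) (b := 104/5) (by norm_num) (Or.inl sign5)
    (mul_neg_of_neg_of_pos sign5 sign6)
  obtain ⟨r₆, hr₆, h₆⟩ := exists_root_of_sign_change (a := 104/5) (b := 91) (by norm_num) (Or.inr sign6)
    (mul_neg_of_pos_of_neg sign6 sign7)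
  obtain ⟨r₇, hr₇, h₇⟩ := exists_root_of_sign_change (a := 91) (b := 472) (by norm_num) (Or.inl sign7)
    (mul_neg_of_neg_of_pos sign7 sign8)
  obtain ⟨r₈, hr₈, h₈⟩ := exists_root_of_sign_change (a := 472) (b := 904) (by norm_num) (Or.inr sign8)
    (mul_neg_of_pos_of_neg sign8 sign9)
  obtain ⟨r₉, hr₉, h₉⟩ := exists_root_of_sign_change (a := 904) (b := 1400) (by norm_num) (Or.inl sign9)
    (mul_neg_of_neg_of_pos sign9 sign10)
  obtain ⟨r₁₀, hr₁₀, h₁₀⟩ := exists_root_of_sign_change (a := 1400) (b := 1890) (by norm_num) (Or.inr sign10)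
    (mul_neg_of_pos_of_neg sign10 sign11)
  obtain ⟨r₁₁, hr₁₁, h₁₁⟩ := exists_root_of_sign_change (a := 1890) (b := 27300) (by norm_num) (Or.inl sign11)
    (mul_neg_of_neg_of_pos sign11 sign12)
  let r : Fin 11 → ℝ := ![r₁, r₂, r₃, r₄, r₅, r₆, r₇, r₈, r₉, r₁₀, r₁₁]
  have hr12 : r₁ < r₂ := lt_trans hr₁.2 hr₂.1
  have hr23 : r₂ < r₃ := lt_trans hr₂.2 hr₃.1
  have hr34 : r₃ < r₄ := lt_trans hr₃.2 hr₄.1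
  have hr45 : r₄ < r₅ := lt_trans hr₄.2 hr₅.1
  have hr56 : r₅ < r₆ := lt_trans hr₅.2 hr₆.1
  have hr67 : r₆ < r₇ := lt_trans hr₆.2 hr₇.1
  have hr78 : r₇ < r₈ := lt_trans hr₇.2 hr₈.1
  have hr89 : r₈ < r₉ := lt_trans hr₈.2 hr₉.1
  have hr910 : r₉ < r₁₀ := lt_trans hr₉.2 hr₁₀.1
  have hr1011 : r₁₀ < r₁₁ := lt_trans hr₁₀.2 hr₁₁.1
  have hmono : StrictMono r := by
    refine Fin.strictMono_iff_lt_succ.2 fun i => ?_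
    fin_cases i
    · exact hr12
    · exact hr23
    · exact hr34
    · exact hr45
    · exact hr56
    · exact hr67
    · exact hr78
    · exact hr89
    · exact hr910
    · exact hr1011
  have hpos : ∀ i, 0 < r i := by
    have h0 : 0 < r₁ := lt_trans (by norm_num) hr₁.1
    have hle : ∀ i : Fin 11, r 0 ≤ r i := fun i => hmono.monotone (Fin.zero_le i)
    intro i
    exact lt_of_lt_of_le h0 (hle i)
  have hroot : ∀ i, detS.IsRoot (r i) := by
    intro i
    fin_cases i
    · exact h₁
    · exact h₂
    · exact h₃
    · exact h₄
    · exact h₅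
    · exact h₆
    · exact h₇
    · exact h₈
    · exact h₉
    · exact h₁₀
    · exact h₁₁
  have hsub : Finset.univ.image r ⊆ detS.roots.toFinset.filter (fun t => 0 < t) := by
    intro t ht
    obtain ⟨i, _, rfl⟩ := Finset.mem_image.1 ht
    refine Finset.mem_filter.2 ⟨?_, hpos i⟩
    rw [Multiset.mem_toFinset]
    exact (Polynomial.mem_roots detS_ne_zero).2 (hroot i)
  have hcard : (Finset.univ.image r).card = 11 := by
    rw [Finset.card_image_of_injective _ hmono.injective]
    simp
  unfold pivotPosRoots
  have := Finset.card_le_card hsub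
  rw [hcard] at this
  exact this

/-! ## Nine kinks -/

/-- the kink number is at most the number of non-zero letter coefficients of the channel -/
theorem kinkNumber_le_card (i : Fin 4) :
    kinkNumber 4 ds cs i ≤ (Finset.univ.filter (fun k => cs k i ≠ 0)).card := by
  unfold kinkNumber
  have h1 := Finset.card_insert_le 4 ((Finset.univ.filter (fun k => cs k i ≠ 0)).image ds)
  have h2 : ((Finset.univ.filter (fun k => cs k i ≠ 0)).image ds).card
      ≤ (Finset.univ.filter (fun k => cs k i ≠ 0)).card := Finset.card_image_le
  omega

/-- channel 1 has ≤ 2 non-zero letter coefficients. -/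
theorem card_ch0 : (Finset.univ.filter (fun k => cs k 0 ≠ 0)).card ≤ 2 := by
  have hsub : (Finset.univ.filter (fun k => cs k 0 ≠ 0)) ⊆ ({1, 3} : Finset (Fin 4)) := by
    intro k hk
    rw [Finset.mem_filter] at hk
    fin_cases k <;> simp_all [cs]
  exact le_trans (Finset.card_le_card hsub) (by decide)

/-- channel 2 has ≤ 2 non-zero letter coefficients. -/
theorem card_ch1 : (Finset.univ.filter (fun k => cs k 1 ≠ 0)).card ≤ 2 := by
  have hsub : (Finset.univ.filter (fun k => cs k 1 ≠ 0)) ⊆ ({0, 2} : Finset (Fin 4)) := by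
    intro k hk
    rw [Finset.mem_filter] at hk
    fin_cases k <;> simp_all [cs]
  exact le_trans (Finset.card_le_card hsub) (by decide)

/-- channel 3 has ≤ 3 non-zero letter coefficients. -/
theorem card_ch2 : (Finset.univ.filter (fun k => cs k 2 ≠ 0)).card ≤ 3 := by
  have hsub : (Finset.univ.filter (fun k => cs k 2 ≠ 0)) ⊆ ({0, 1, 3} : Finset (Fin 4)) := by
    intro k hk
    rw [Finset.mem_filter] at hk
    fin_cases k <;> simp_all [cs]
  exact le_trans (Finset.card_le_card hsub) (by decide)

/-- channel 4 has ≤ 2 non-zero letter coefficients. -/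
theorem card_ch3 : (Finset.univ.filter (fun k => cs k 3 ≠ 0)).card ≤ 2 := by
  have hsub : (Finset.univ.filter (fun k => cs k 3 ≠ 0)) ⊆ ({0, 2} : Finset (Fin 4)) := by
    intro k hk
    rw [Finset.mem_filter] at hk
    fin_cases k <;> simp_all [cs]
  exact le_trans (Finset.card_le_card hsub) (by decide)

/-- **Nine kinks**: `Σᵢ κᵢ ≤ 9` for the witness. -/
theorem sum_kinkNumber_le : ∑ i, kinkNumber 4 ds cs i ≤ 9 := by
  rw [Fin.sum_univ_four]
  have h0 := le_trans (kinkNumber_le_card 0) card_ch0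
  have h1 := le_trans (kinkNumber_le_card 1) card_ch1
  have h2 := le_trans (kinkNumber_le_card 2) card_ch2
  have h3 := le_trans (kinkNumber_le_card 3) card_ch3
  omega


end KinkLaw

open KinkLaw in
/-- **«One root per kink» is FALSE** (conjb-1 g3): `¬ SecularKinkLaw` — the pruned multiplexed staircase has eleven positive roots on
nine kinks (`1 + Σκ ≤ 10 < 11`). -/
theorem not_secularKinkLaw : ¬ SecularKinkLaw := by
  intro h
  have h10 : pivotPosRoots 4 ds Jw Pw ≤ 1 + ∑ i, kinkNumber 4 ds cs i :=
    h 4 4 4 ds γs ws cs γs_nonneg cs_nonneg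
  have h11 := eleven_le_pivotPosRoots
  have h9 := sum_kinkNumber_le
  omega

end Summit.ValiantsHypothesis.ValiantsHypothesis.Theorems.LacunarySymmetroidMatrixDescartes.Pivot
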